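import Mathlib.RingTheory.Etale.StandardEtale
import Mathlib.RingTheory.AdjoinRoot
import HarnessLib

/-!
# [OURS · L1 W4.5(b) · EL♮] TAME KUMMER ALGEBRAS ARE ÉTALE: `R[τ]/(τ^m − u)` is a (standard) étale, finite free `R`-algebra when `m·u` is a unit
# — the local algebra of the «étale untwisting after the ramified base change» in DSHARP-VOID §3 (Theorems A/A′: pure tame ribbons are dead)
# (crux `EquisingularLiftNat` = stmt-ResolutionOfSingularities-20038; PARENT ≥ 4 band / kill test #50)

HONEST FRAMING. OURS (cell res-hironaka, crux chain w45b, slot W4.5(b)); NOT a statement of any manuscript; replaces the role of NOTHING in the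
manuscript; AI-written, AI review is weaker than expert review. Helper `--supports stmt-ResolutionOfSingularities-20038 --as helper`.
Memo `L/res-L1-w45b-lead-1/DSHARP-VOID.md` §3: for a regular `O`-flat `C` with `C_s = m·Z`, `Z = V(t)` regular, `ϖ = u t^m` with `u` a unit and
`p ∤ m`, the normalisation of `C ⊗_O O[ϖ^{1/m}]` is locally `𝒪_C[τ]/(τ^m − u)`, `τ = ϖ^{1/m}/t`; THIS FILE proves the ring fact used there: that algebra is
ÉTALE (indeed standard étale: `f = X^m − u`, `g = 1`, `f′·(X/(mu)) − f·(1/u) = 1`) and finite free of rank `m` over `R` — so `C′ → C` is finite étale,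
`C′` is regular and its special fibre `Z ×_C C′` is an étale cover of `Z` (the rest of §3 is by hand).

* `KummerEtale.derivative_mul_add_mul` — the Bézout identity making `(X^m − C u, 1)` a `StandardEtalePair` when `IsUnit ((m : R) * u)`;
* `KummerEtale.etale` — **`Algebra.Etale R (AdjoinRoot (X^m − C u))`** (via Mathlib's standard étale algebra of that pair and `g = 1`:
  `P.Ring ≃ (R[X]/f)[1/1] ≃ R[X]/f`, `IsLocalization.atUnits`); `KummerEtale.finite` / `free` — finite free (power basis of the monic `X^m − C u`).

References: Mathlib `StandardEtalePair`, `Algebra.Etale.of_equiv`, `AdjoinRoot.powerBasis'`; [StacksProject, Tag 00UB (standard étale)]. [folklore]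
-/

set_option linter.dupNamespace false -- mandated namespace `Summit.<Summit>.<Problem>` of this single-conjunct summit

noncomputable section

universe u

open Polynomial

namespace Summit.ResolutionOfSingularities.ResolutionOfSingularities.Cruxes.EquisingularLiftNat.Sections

namespace KummerEtale

variable {R : Type u} [CommRing R] {m : ℕ} {u : R}

/-- `m ≠ 0` when `m · u` is a unit of a nontrivial ring. [folklore] -/
theorem m_ne_zero [Nontrivial R] (h : IsUnit ((m : R) * u)) : m ≠ 0 := by
  rintro rfl
  simp at h

/-- The Bézout identity `f′ · (a X) + f · (−m a) = 1` for `f = X^m − u`, `a = (m u)⁻¹`: the derivative of a tame Kummer polynomial is a unit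
modulo `f`. [folklore] -/
theorem derivative_mul_add_mul [Nontrivial R] (h : IsUnit ((m : R) * u)) :
    derivative (X ^ m - C u : R[X]) * (C (↑h.unit⁻¹ : R) * X) + (X ^ m - C u) * (-(C ((m : R) * ↑h.unit⁻¹))) = (1 : R[X]) ^ 0 := by
  have hmu : (m : R) * u * ↑h.unit⁻¹ = 1 := h.mul_val_inv
  obtain ⟨k, hk⟩ := Nat.exists_eq_succ_of_ne_zero (m_ne_zero h)
  subst hk
  rw [derivative_sub, derivative_X_pow, derivative_C, sub_zero, Nat.succ_sub_one, pow_zero]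
  -- `(k+1) X^k · (a X) − (X^{k+1} − u) · ((k+1) a) = (k+1) a u = 1`
  have e : C ((k.succ : ℕ) : R) * X ^ k * (C (↑h.unit⁻¹ : R) * X) + (X ^ k.succ - C u) * (-(C (((k.succ : ℕ) : R) * ↑h.unit⁻¹))) =
      C (((k.succ : ℕ) : R) * u * ↑h.unit⁻¹) := by
    simp only [map_mul, map_natCast, pow_succ]
    ring
  rw [e, hmu, map_one]

/-- **TAME KUMMER ALGEBRAS ARE ÉTALE**: if `m · u` is a unit of the (nontrivial) ring `R` then `R[X]/(X^m − u)` is an étale `R`-algebra —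
it is the standard étale algebra of the pair `(f, g) = (X^m − u, 1)` (Mathlib `StandardEtalePair`; `g = 1`, so the localisation
`(R[X]/f)[1/g]` is `R[X]/f` itself, `IsLocalization.atUnits`). OURS. [cite: StacksProject, Tag 00UB] -/
theorem etale [Nontrivial R] (h : IsUnit ((m : R) * u)) : Algebra.Etale R (AdjoinRoot (X ^ m - C u : R[X])) := by
  -- the standard étale pair `(X^m − u, 1)`
  let P : StandardEtalePair R :=
    { f := X ^ m - C u
      monic_f := monic_X_pow_sub_C u (m_ne_zero h)
      g := 1
      cond := ⟨_, _, 0, derivative_mul_add_mul h⟩ }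
  haveI : Algebra.Etale R P.Ring := inferInstance
  -- `P.Ring ≃ (R[X]/f)[1/1] ≃ R[X]/f`
  have h1 : AdjoinRoot.mk P.f P.g = 1 := map_one _
  let e₁ : P.Ring ≃ₐ[R] Localization.Away (AdjoinRoot.mk P.f P.g) := P.equivAwayAdjoinRoot
  rw [h1] at e₁
  let e₂ : Localization.Away (1 : AdjoinRoot (X ^ m - C u : R[X])) ≃ₐ[R] AdjoinRoot (X ^ m - C u : R[X]) :=
    ((IsLocalization.atUnits (R := AdjoinRoot (X ^ m - C u : R[X])) (M := Submonoid.powers (1 : AdjoinRoot (X ^ m - C u : R[X])))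
      (S := Localization.Away (1 : AdjoinRoot (X ^ m - C u : R[X]))) (by rintro x ⟨n, rfl⟩; simp)).restrictScalars R).symm
  exact Algebra.Etale.of_equiv (e₁.trans e₂)

/-- `R[X]/(X^m − u)` is a finite `R`-module (power basis `1, X, …, X^{m−1}` of the monic `X^m − u`). [folklore] -/
theorem finite [Nontrivial R] (h : IsUnit ((m : R) * u)) : Module.Finite R (AdjoinRoot (X ^ m - C u : R[X])) :=
  .of_basis (AdjoinRoot.powerBasis' (monic_X_pow_sub_C u (m_ne_zero h))).basis

/-- `R[X]/(X^m − u)` is a free `R`-module. [folklore] -/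
theorem free [Nontrivial R] (h : IsUnit ((m : R) * u)) : Module.Free R (AdjoinRoot (X ^ m - C u : R[X])) :=
  .of_basis (AdjoinRoot.powerBasis' (monic_X_pow_sub_C u (m_ne_zero h))).basis

end KummerEtale

end Summit.ResolutionOfSingularities.ResolutionOfSingularities.Cruxes.EquisingularLiftNat.Sections
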